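import Mathlib
import HarnessLib
import Summits.HubbardSuperconductivity.HubbardSuperconductivity.Theorems.KLProgrammeThermalGreenHubbardTorusExact
import Summits.HubbardSuperconductivity.HubbardSuperconductivity.Theorems.KLProgrammeThermalTwoPointMomentumBridge

/-!
# KMS bridge: the particle-ordered two-time function `⟨c_{yσ'}(τ) c†_{xσ}⟩` of the `…ThermalGreen*` files IS the tree's
# imaginary-time two-point function `hubbardThermalTwoPointTime β U μ L (β − τ) x y σ σ'` (seat hubbard-kl-k3c5-p2, g2)

Route `KLProgramme`, child 5 (stmt-HubbardSuperconductivity-19826).  The a-priori bounds of `…ThermalGreenHubbardTorus[Exact]` are stated for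
`∫₀^β e^{ik₀τ} ⟨c(τ) c†⟩_{H−μN} dτ` with `⟨A(τ)B⟩ = Matrix.gibbsState β H (Matrix.imagTimeEvolve H τ A * B)`.  The cell's two-point vocabulary
(`…ThermalTwoPointMomentumDefs`, definition item D1) is `hubbardThermalTwoPointTime β U μ L τ x y σ σ' = Z⁻¹Tr(e^{−(β−τ)H} c†_{xσ} e^{−τH} c_{yσ'})
= ⟨c†_{xσ}(τ) c_{yσ'}⟩`.  The two are related by KMS:

* `gibbsState_imagTimeEvolve_mul_kms` — generic: `⟨A(s) B⟩_β = ⟨B(β − s) A⟩_β` (any matrices, any complex time);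
* `hubbardThermalTwoPointTime_eq_gibbsState` — `hubbardThermalTwoPointTime β U μ L τ x y σ σ' = ⟨c†_{x̄σ}(τ) c_{ȳσ'}⟩` (`0 ≤ τ`, `L ≠ 0`);
* `gibbsState_annihilation_evolve_creation_eq_thermalTwoPointTime` — **`⟨c_{ȳσ'}(τ) c†_{x̄σ}⟩ = hubbardThermalTwoPointTime β U μ L (β − τ) x y σ σ'`**
  for `τ ≤ β` — so `𝒢_L(k₀, k)` of `…ThermalGreenHubbardTorusExact` is the Matsubara–Fourier transform of `τ ↦ hubbardThermalTwoPointTime … (β − τ) …`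
  summed against the plane waves of `momentumAnnihilation`/`momentumCreation`.  Everything is proved; no definition.
-/

noncomputable section

namespace Summit.HubbardSuperconductivity.HubbardSuperconductivity.Theorems.ThermalGreen

set_option linter.dupNamespace false -- summit = problem name (single-conjunct summit), D-0017

open scoped Matrix.Norms.L2Operator
open Matrix Complex Literature.MathematicalPhysics.QuantumLattice Literature.Probability.LatticeModels
open Summit.HubbardSuperconductivity.HubbardSuperconductivity.Theorems.KLProgrammeTwoPoint

/-- **KMS, two-time form**: `⟨A(s) B⟩_β = ⟨B(β − s) A⟩_β` (KMS `⟨XY⟩ = ⟨Y(β)X⟩`, then stationarity `⟨(B(β−s)A)(s)⟩ = ⟨B(β−s)A⟩`). -/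
theorem gibbsState_imagTimeEvolve_mul_kms {n : Type*} [Fintype n] [DecidableEq n] (β : ℝ) (H A B : Matrix n n ℂ) (s : ℂ) :
    gibbsState β H (imagTimeEvolve H s A * B) = gibbsState β H (imagTimeEvolve H ((β : ℂ) - s) B * A) := by
  rw [gibbsState_mul_eq_gibbsState_imagTimeEvolve_mul, gibbsState_imagTimeEvolve_mul_imagTimeEvolve]

variable {L : ℕ} [NeZero L]

/-- **The D1 object as a two-time Gibbs correlation**: for `0 ≤ τ`,
`hubbardThermalTwoPointTime β U μ L τ x y σ σ' = ⟨c†_{x̄σ}(τ) c_{ȳσ'}⟩_{H−μN}` (`x̄ = Torus.proj L x`). -/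
theorem hubbardThermalTwoPointTime_eq_gibbsState (β U μ : ℝ) {τ : ℝ} (hτ : 0 ≤ τ) (x y : Site 2) (σ σ' : Fin 2) :
    hubbardThermalTwoPointTime β U μ L τ x y σ σ' =
      gibbsState β (hubbardTorusWith 2 L 1 U μ)
        (imagTimeEvolve (hubbardTorusWith 2 L 1 U μ) (τ : ℂ) (creation (orb (FermionTorus.ofTorusSite (Torus.proj L x)) σ)) *
          annihilation (orb (FermionTorus.ofTorusSite (Torus.proj L y)) σ')) := by
  rw [hubbardThermalTwoPointTime_eq_neg_schwinger β U μ L hτ x y σ σ', hubbardSchwingerTwoPoint_eq,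
    Matrix.schwingerTwoPoint_of_le _ _ _ _ hτ, neg_neg, Complex.ofReal_zero, imagTimeEvolve_zero]

/-- **THE BRIDGE**: for `τ ≤ β`, `⟨c_{ȳσ'}(τ) c†_{x̄σ}⟩_{H−μN} = hubbardThermalTwoPointTime β U μ L (β − τ) x y σ σ'` — the particle-ordered
two-time function of the `…ThermalGreen*` bounds is the tree's imaginary-time two-point function at the reflected time. -/
theorem gibbsState_annihilation_evolve_creation_eq_thermalTwoPointTime (β U μ : ℝ) {τ : ℝ} (hτ : τ ≤ β) (x y : Site 2)
    (σ σ' : Fin 2) :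
    gibbsState β (hubbardTorusWith 2 L 1 U μ)
        (imagTimeEvolve (hubbardTorusWith 2 L 1 U μ) (τ : ℂ) (annihilation (orb (FermionTorus.ofTorusSite (Torus.proj L y)) σ')) *
          creation (orb (FermionTorus.ofTorusSite (Torus.proj L x)) σ)) =
      hubbardThermalTwoPointTime β U μ L (β - τ) x y σ σ' := by
  rw [gibbsState_imagTimeEvolve_mul_kms, hubbardThermalTwoPointTime_eq_gibbsState β U μ (sub_nonneg.mpr hτ), Complex.ofReal_sub]

/-- The same with Bloch modes on both sides: `⟨c_{kσ}(τ) c†_{kσ}⟩ = Σ_{x,y} L⁻² χ_k(x) conj χ_k(y) · ⟨c_{yσ}(τ) c†_{xσ}⟩` (bilinearity; the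
site correlations are the `hubbardThermalTwoPointTime`'s of the previous lemma at torus sites). -/
theorem gibbsState_momentum_evolve_eq_sum (β U μ : ℝ) (τ : ℂ) (k : TorusSite 2 L) (σ : Fin 2) :
    gibbsState β (hubbardTorusWith 2 L 1 U μ)
        (imagTimeEvolve (hubbardTorusWith 2 L 1 U μ) τ (momentumAnnihilation k σ) * momentumCreation k σ) =
      ∑ y : FermionTorus 2 L, ∑ x : FermionTorus 2 L,
        (torusFourierWeight 2 L * (starRingEnd ℂ) (torusChar k y.toTorusSite)) * (torusFourierWeight 2 L * torusChar k x.toTorusSite) *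
          gibbsState β (hubbardTorusWith 2 L 1 U μ)
            (imagTimeEvolve (hubbardTorusWith 2 L 1 U μ) τ (annihilation (orb y σ)) * creation (orb x σ)) := by
  rw [momentumCreation_eq_sum]
  unfold momentumAnnihilation
  set H := hubbardTorusWith 2 L 1 U μ with hH
  -- push the sums and scalars through `imagTimeEvolve`, the product and the state
  have hlin : imagTimeEvolve H τ (∑ y : FermionTorus 2 L, (torusFourierWeight 2 L * (starRingEnd ℂ) (torusChar k y.toTorusSite)) •
      annihilation (orb y σ)) =
      ∑ y : FermionTorus 2 L, (torusFourierWeight 2 L * (starRingEnd ℂ) (torusChar k y.toTorusSite)) • imagTimeEvolve H τ (annihilation (orb y σ)) := by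
    simp only [imagTimeEvolve_eq, Finset.mul_sum, Finset.sum_mul, Matrix.mul_smul, Matrix.smul_mul]
  rw [hlin, Finset.sum_mul, map_sum]
  refine Finset.sum_congr rfl fun y _ => ?_
  rw [Matrix.smul_mul, Finset.mul_sum, Finset.smul_sum, map_sum]
  refine Finset.sum_congr rfl fun x _ => ?_
  rw [Matrix.mul_smul, smul_smul, map_smul, smul_eq_mul]

end Summit.HubbardSuperconductivity.HubbardSuperconductivity.Theorems.ThermalGreen

end
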